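import Summits.HodgeConjecture.HodgeConjecture.Theorems.F0P3cStCharTSEPCrossNormZeroNotWild  -- ★ p853794 (X0′-NW) THE SOCKET `innerG_char_cross_eq_zero_of_not_wild` (LH6-p03; over ★ 73 ∕ ★ row 80 F0P3-p02)
import Summits.HodgeConjecture.HodgeConjecture.Theorems.F0P3cStCharTSEPNormOneOfHsplit          -- ★ 73 (letters of the NW socket; PCT-OUT, TorusDefs, `Gqs`, the §12.5 datum currency)
import Summits.HodgeConjecture.HodgeConjecture.Theorems.F0P3JacquetEmbeddingDichotomy         -- ★ D2′ `isSupercuspidal_or_exists_injective_intertwiningMap_cmPrincipalSeries_of_irrClass`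
import Summits.HodgeConjecture.HodgeConjecture.Theorems.F0P3cStCharTSJacLen1                   -- ★ `n1_line_data` (N1 in theorem-world: `dim r_B i_G(χ) = 2`)
import Summits.HodgeConjecture.HodgeConjecture.Theorems.F0P3U3LengthLeTwoOfEmbeds             -- ★ `nontrivial_coinvariants_of_isConstituentOf_cmPrincipalSeries`, `isSmooth_cmPrincipalSeries`
import Summits.HodgeConjecture.HodgeConjecture.Theorems.F0P3U3ConstituentEmbedsOfJacquet       -- ★ N2 `u3PrincipalSeriesConstituentEmbeds_of_jacquetFiltration`
import Summits.HodgeConjecture.HodgeConjecture.Theorems.F0P3U3PrincipalSeriesJacquetFiltrationHolds  -- ★ N1 `U3PrincipalSeriesJacquetFiltration_holds`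
import Summits.HodgeConjecture.HodgeConjecture.Theorems.F0P3cStCharTSFrobeniusNaturality       -- ★ `cmPrincipalSeries_eq_normalizedInd` (rfl bridge), `deltaChar_cmBorelTriple_eq_one_of_mem_N`
import Summits.HodgeConjecture.HodgeConjecture.Theorems.F0P3cStCharTSP1261bOfCases             -- ★ `innerG_ne_zero_comm`
import Literature.NumberTheory.Automorphic.JacquetIsotypicExtensionSplitting                    -- ★ row 79 (SEP) `exists_section_or_exists_injective_of_isotypic_normalizedJacquet` (F0P3a-p06)
import Literature.NumberTheory.Automorphic.JacquetRankStrictMono                                -- ★ `finrank_coinvariants_eq_one_of_ne_bot_of_ne_top`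
import Literature.NumberTheory.Automorphic.JacquetNonvanishingOfEmbedding                       -- ★ `normalizedJacquet_apply_eq_smul_of_finrank_eq_one_of_intertwiningMap_normalizedInd`
import Literature.NumberTheory.Automorphic.IrreducibleClassesConstituents                       -- ★ `IsConstituentOf.of_injective` ∕ `.of_surjective`, `isConstituentOf_mk_self`
import Literature.RepresentationTheory.Semisimple.SubrepresentationEquiv                        -- ★ `Representation.isIrreducible_of_equiv`
import Literature.NumberTheory.Automorphic.IrrClassSchurHomZero                                 -- ★ p853779 HOM-ZERO `SmoothIrrep.subsingleton_intertwiningMap_of_mk_ne_mk` (LH6-p04)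
import HarnessLib

/-!
# F0 · P3c · line LH6 «StCharTS» — (X3′) ASSEMBLY of the EXT-ROAD v2 rider «(b)-REST NOT-WILD»: Prop. 12.6.1 (b) for ALL pairs of elliptic non-supercuspidal classes at a
# NOT-WILD place, from the cross-trace-zero socket, line-Jacquet block separation and Rogawski's §12.2 list — NO character value, NO print letter

Cell `pub/hodgecm-mathlib`, crux H413 = `stmt-HodgeConjecture-24833` (`--supports … --as helper`); EXT-ROAD census (LH6-p04 (g12) 85875cce) + CENSUS-R76 (F0P3a-p06 (g27)
4d08d059), priced by LEAD F0P3a-plan (g17) T16-03 as rider «(b)-REST NOT-WILD» (consequent 3 of the block re-guarded by `¬ NOT-WILD →`); assembler «LH6» LH6-p04 (g12)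
(keeper F0P3a-p03 (g32) k02 (b)).  THEOREMS ONLY (no definition ∕ instance ∕ notation ∕ named fact ∕ `sorry`).

THE MATHEMATICS ([Rogawski1990 §12.6 Prop. 12.6.1 (b) p. 188]; R76 (S-A)(S-B)(S-C)).  Let `π ≠ π′` be elliptic non-supercuspidal classes of `G = U(Φ₃)(L⁺_v)` (`v` non-split,
NOT WILD) with `⟨χ_π, χ_π′⟩_e ≠ 0`.  Realise `π = ⟦r⟧ ↪ I = i_G(χ)` and `π′ = ⟦r′⟧ ↪ I′ = i_G(χ′)` (★ D2′).  CLAIM: `π ∈ JH(I′)`.  If not: `χ ≠ χ′` (else `I = I′`); `I` is not irreducible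
(its constituent `π` is elliptic, ★ `hVan`), so `r_B(r) ` is a LINE on which `T` acts by `χ` (§1: ★ N1 `dim r_B I = 2`, ★ strict monotonicity of Jacquet ranks, ★ the Frobenius line
lemma); ★ (SEP) then says that every smooth extension `0 → r′ → E → r → 0` SPLITS (its other alternative embeds `E` in `I′`, putting `π` in `JH(I′)`); with Schur for `⟦r⟧ ≠ ⟦r′⟧`
(Mathlib) the CROSS-TRACE-ZERO socket (★ row 80 ∕ (X0′-NW): `⟨χ_π′, χ_π⟩_e = tr π′(f_EP^π) = dim Hom(C₀^π, π′) − dim Hom(C₁^π, π′) = 0`) contradicts `⟨χ_π, χ_π′⟩_e ≠ 0`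
(★ `innerG_ne_zero_comm`).  HENCE `π, π′ ∈ JH(I′)`, `I′` is reducible, and Rogawski's §12.2 list (`hRedJH`, the text ★ ELL-CLASS consumes, produced by ★ RED-JH from the organ's
outer letter `hKeysRed` and the label pins) names `{π, π′}` as an l.d.s. packet, `{St_G ψ, ψ∘det_G}` or `{π²(ξ), πⁿ(ξ)}` — i.e. `𝔇.IsEllipticPair π π′`.
NOT CIRCULAR: no value of any character, no 12.6.1 (a)∕(b)∕(c), no K2′, no trace formula beyond ★ WIF∕PCT inside the socket.
SOCKET: ★ (X0′-NW) `F0P3cStCharTSEPCrossNormZeroNotWild.innerG_char_cross_eq_zero_of_not_wild` (p853794, LH6-p03) called BY NAME with its own letters — no HOME-only binder (T16-04 (2)).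
HONEST LABEL: count-neutral until the ride; 12.6.1 (b)-rest = PRINT of record; h413 OPEN; HC_CM is proved only modulo the 7 printed citations (2 remaining named inputs
hLiu418 = `stmt-HodgeConjecture-24832`, h413 = `stmt-HodgeConjecture-24833`) until rung 0 closes.

## References
* [Rogawski1990] J. D. Rogawski, *Automorphic Representations of Unitary Groups in Three Variables*, Ann. of Math. Stud. 123 (1990), §12.2 pp. 172–174; §12.6 Prop. 12.6.1 (b) p. 188.
* [BernsteinZelevinsky1977] I. N. Bernstein, A. V. Zelevinsky, *Induced representations of reductive p-adic groups I*, Ann. Sci. ÉNS 10 (1977), §1.9, §2.3, Thm. 2.8.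
* [Casselman1995] W. Casselman, *Introduction to the theory of admissible representations of p-adic reductive groups* (1995), §3.2, §6.3, §7.1.
* [Keys1984] D. Keys, *Principal series representations of special unitary groups over local fields*, Compositio Math. 51 (1984), §7.
-/

set_option autoImplicit false
-- the mandated namespace has the single-problem summit's repeated segment (`HodgeConjecture.HodgeConjecture`)
set_option linter.dupNamespace false

noncomputable section

open NumberField IsDedekindDomain MeasureTheory Filter Topology
open scoped Matrix MatrixGroups
open Literature.NumberTheory.Rogawski1990 Literature.NumberTheory.Rogawski1990.Ch12Sec5
open Literature.NumberTheory.Automorphic Literature.NumberTheory.Automorphic.UnitaryGroup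

namespace Summit.HodgeConjecture.HodgeConjecture.Cruxes.H413.F0P3cStCharTSP1261bRestNotWild

open Summit.HodgeConjecture.HodgeConjecture.Cruxes.H413 Summit.HodgeConjecture.HodgeConjecture.Cruxes.H413.F0P3cStCharTSTorusDefs

variable (L : Type) [Field L] [NumberField L] [IsCMField L] (v : HeightOneSpectrum (𝓞 ↥(maximalRealSubfield L)))

/-! ## §1 THE JACQUET LINE of an irreducible embedded in a REDUCIBLE principal series: `T` acts on `r_B(r)` by the inducing character -/

set_option maxHeartbeats 8000000 in
set_option synthInstance.maxHeartbeats 400000 in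
-- budget: the `SmoothInd` carrier of `cmPrincipalSeries` and its `Subrepresentation` lattice (class of ★ RED-JH §1 16M ∕ ★ JAC-LEN1)
/-- **If an irreducible smooth `r` of `U(Φ₃)(L⁺_v)` (non-split `v`) embeds in a NOT irreducible `i_G(χ₁, χ₂)` (continuous pair), then `r_B(r)` is a line on which the torus acts by
`(χ₁, χ₂)`**: `dim r_B i_G(χ) = 2` (★ N1), the image of `r` is a subrepresentation `⊥ ≠ N ≠ ⊤` (an isomorphism onto `i_G(χ)` would make it irreducible), every constituent of `i_G(χ)`
has a non-zero Jacquet module (★ N2), so `dim r_B(N) = 1` (★ strict monotonicity of Jacquet ranks) and `dim r_B(r) = 1` (★ `jacquetMap_injective`); then the Frobenius line lemma (★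
`normalizedJacquet_apply_eq_smul_of_finrank_eq_one_of_intertwiningMap_normalizedInd`). [cite: Casselman1995, §7.1 Prop. 7.1.3 p. 67; §3.2] [cite: BernsteinZelevinsky1977, §2.3, Thm. 2.8] -/
theorem normalizedJacquet_eq_smul_of_injective_of_not_isIrreducible (hns : ∀ w : PlacesOver L v, IsCMField.complexConj L • w.1 = w.1)
    (χ₁ : (LocalRing L v)ˣ →* ℂˣ) (χ₂ : ↥(normOneUnits (conjLocal L (IsCMField.complexConj L) v)) →* ℂˣ)
    (h1c : Continuous fun x => ((χ₁ x : ℂˣ) : ℂ)) (h2c : Continuous fun x => ((χ₂ x : ℂˣ) : ℂ))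
    (r : SmoothIrrep (Gqs L v)) (φ : r.ρ.IntertwiningMap (cmPrincipalSeries L 3 v (cmTorusCharPair L v χ₁ χ₂))) (hφ : Function.Injective φ)
    (hI : ¬ (cmPrincipalSeries L 3 v (cmTorusCharPair L v χ₁ χ₂)).IsIrreducible) :
    haveI := locallyCompactSpace_cmBorelU L 3 v
    ∀ (m : ↥(cmBorelTriple L 3 v).M) (x : ((cmBorelTriple L 3 v).restrict r.ρ).Coinvariants),
      r.ρ.normalizedJacquet (cmBorelTriple L 3 v) m x = ((cmTorusCharPair L v χ₁ χ₂ m : ℂˣ) : ℂ) • x := by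
  haveI := locallyCompactSpace_cmBorelU L 3 v
  intro m x
  -- the irreducibility instance of `r.ρ`, declared at the literal carrier (`Gqs L v` unfolds to it by `rfl`, not reducibly)
  haveI hirrC : Representation.IsIrreducible (G := ↥(unitaryGroupOfForm (conjLocal L (IsCMField.complexConj L) v) (cmLocalForm L 3 v))) r.ρ :=
    r.isIrreducible
  haveI hirrG : r.ρ.IsIrreducible := r.isIrreducible
  obtain ⟨hfd, h2, -⟩ := F0P3cStCharTSJacLen1.n1_line_data L v hns χ₁ χ₂ h1c h2c
  haveI := hfd
  have hN : IsLimitOfCompactOpen ↥(cmBorelTriple L 3 v).N := isLimitOfCompactOpen_cmBorelTriple_N L 3 v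
  have hIsm := F0P3U3LengthLeTwoOfEmbeds.isSmooth_cmPrincipalSeries L v (cmTorusCharPair L v χ₁ χ₂)
  have hN2 : U3PrincipalSeriesConstituentEmbeds L :=
    F0P3U3ConstituentEmbedsOfJacquet.u3PrincipalSeriesConstituentEmbeds_of_jacquetFiltration L
      (F0P3U3PrincipalSeriesJacquetFiltrationHolds.U3PrincipalSeriesJacquetFiltration_holds L)
  have hcons : ∀ c : IrrClass (Gqs L v), c.IsConstituentOf (cmPrincipalSeries L 3 v (cmTorusCharPair L v χ₁ χ₂)) →
      ∃ r' : SmoothIrrep (Gqs L v), IrrClass.mk r' = c ∧ Nontrivial ((cmBorelTriple L 3 v).restrict r'.ρ).Coinvariants := fun c hc =>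
    F0P3U3LengthLeTwoOfEmbeds.nontrivial_coinvariants_of_isConstituentOf_cmPrincipalSeries L hN2 v hns χ₁ χ₂ h1c h2c c hc
  -- the image `N = φ(r)`: a subrepresentation with `⊥ ≠ N ≠ ⊤`
  haveI : Nontrivial r.V := Representation.IsIrreducible.nontrivial r.ρ
  have hbot : φ.range ≠ ⊥ := by
    intro h0
    obtain ⟨x, hx⟩ := exists_ne (0 : r.V)
    have hmem : φ x ∈ φ.range := ⟨x, rfl⟩
    rw [h0] at hmem
    have hx0 : φ x = 0 := hmem
    exact hx (hφ (by rw [hx0, map_zero]))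
  have htop : φ.range ≠ ⊤ := by
    intro htop
    have hsurj : Function.Surjective φ := fun y => by
      have hy : y ∈ φ.range := by rw [htop]; trivial
      exact hy
    have e : r.ρ.Equiv (cmPrincipalSeries L 3 v (cmTorusCharPair L v χ₁ χ₂)) := Representation.IntertwiningMap.ofBijective φ ⟨hφ, hsurj⟩
    exact hI (@Literature.RepresentationTheory.Semisimple.Representation.isIrreducible_of_equiv _ _ _ _ _ _ _ _ _ _ _ _ e hirrG)
  have h1N := Representation.finrank_coinvariants_eq_one_of_ne_bot_of_ne_top (cmBorelTriple L 3 v) hN hIsm hcons h2 hbot htop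
  -- `r ≅ N` by the corestriction of `φ`, so `r_B(r) ≅ r_B(N)` (★ exactness: injective + surjective Jacquet map) and `dim r_B(r) = 1`
  let φN : r.ρ.IntertwiningMap φ.range.toRepresentation :=
    { toLinearMap := LinearMap.codRestrict φ.range.toSubmodule φ.toLinearMap (fun x => ⟨x, rfl⟩)
      isIntertwining' := fun g => by
        refine LinearMap.ext fun x => Subtype.ext ?_
        change φ (r.ρ g x) = (cmPrincipalSeries L 3 v (cmTorusCharPair L v χ₁ χ₂)) g (φ x)
        exact φ.isIntertwining _ _ g x }
  have hφN : Function.Injective φN := fun a b hab => hφ (congrArg Subtype.val hab :)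
  have hφNs : Function.Surjective φN := by
    rintro ⟨w, ⟨x, hx⟩⟩
    exact ⟨x, Subtype.ext hx⟩
  have hinjN := Representation.jacquetMap_injective (cmBorelTriple L 3 v) hN (hIsm.toRepresentation φ.range) φN hφN
  have hsurjN := Representation.jacquetMap_surjective (cmBorelTriple L 3 v) φN hφNs
  have h1 : Module.finrank ℂ ((cmBorelTriple L 3 v).restrict r.ρ).Coinvariants = 1 := by
    rw [← h1N]
    exact (LinearEquiv.ofBijective (Representation.jacquetMap (cmBorelTriple L 3 v) φN).toLinearMap ⟨hinjN, hsurjN⟩).finrank_eq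
  -- the Frobenius line lemma (`φ ≠ 0` since `φ` is injective on `r ≠ 0`); `i_G(χ) = normalizedInd (ℂ_χ)` by `rfl` (★ `cmPrincipalSeries_eq_normalizedInd`)
  let φ' : r.ρ.IntertwiningMap (Representation.normalizedInd (cmBorelTriple L 3 v)
      ((Representation.trivial ℂ ↥(torusU (conjLocal L (IsCMField.complexConj L) v) (cmLocalForm L 3 v)) ℂ).twist (cmTorusCharPair L v χ₁ χ₂))) := φ
  have hφ'0 : φ' ≠ 0 := by
    intro h0
    obtain ⟨x, hx⟩ := exists_ne (0 : r.V)
    have : φ x = 0 := by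
      change φ' x = 0
      rw [h0]; rfl
    exact hx (hφ (by rw [this, map_zero]))
  exact Representation.normalizedJacquet_apply_eq_smul_of_finrank_eq_one_of_intertwiningMap_normalizedInd (cmBorelTriple L 3 v) r.ρ
    (deltaChar_cmBorelTriple_eq_one_of_mem_N L 3 v) r.isSmooth (cmTorusCharPair L v χ₁ χ₂) h1 φ' hφ'0 m x


/-! ## §2 THE HEAD — consequent 3 of the block at every NOT-WILD place, no EP-family guard; junction letters only (the (X0′-NW) socket's + ★ ELL-CLASS's) -/

set_option maxHeartbeats 8000000 in
set_option synthInstance.maxHeartbeats 400000 in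
-- budget: three `IsConstituentOf (cmPrincipalSeries …)` shapes of `hRedJH` + the NW socket's datum letters at the literal carrier (class of ★ RED-JH ∕ ★ 73)
/-- **PROP. 12.6.1 (b) FOR EVERY PAIR OF ELLIPTIC NON-SUPERCUSPIDAL CLASSES AT A NOT-WILD PLACE** (the text of consequent 3 of the block after its guards, with NO EP-family
exclusion).  HYPOTHESES: the (X0′-NW) socket's letters VERBATIM (`hns hv` + the §12.5 datum `νQv mQv hcanQ 𝔇 hμG horb hreg hE hM1` + ★ PCT-OUT's `hWIF hC1 hC2 hC3 hL2`, = ★ 73 :345's §NW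
block), then ★ ELL-CLASS's three inputs VERBATIM (`hVan`, `hLds2`, `hRedJH` — the junction discharges `hRedJH` by ★ RED-JH `redJH_of_keysRed` from the outer letter `hKeysRed` and the label pins).
The cross-trace socket ★ `innerG_char_cross_eq_zero_of_not_wild` is called BY NAME (rule-26 place token `hv`).
PROOF: see the module docstring (realise both classes in principal series ★ D2′; block separation ★ 79 over the Jacquet line §1; Schur ★ HOM-ZERO; the socket; ★ `innerG_ne_zero_comm`;
then Rogawski's list `hRedJH` on the common reducible series). [cite: Rogawski1990, §12.6 Prop. 12.6.1 (b) p. 188; §12.2 pp. 172–174] [cite: Casselman1995, §6.3, §7.1] -/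
theorem isEllipticPair_of_innerG_ne_zero_of_not_wild
    (hns : ∀ w : PlacesOver L v, IsCMField.complexConj L • w.1 = w.1) (hv : Algebra.IsUnramifiedIn (𝓞 L) v.asIdeal ∨ Valued.v (2 : v.adicCompletion ↥(maximalRealSubfield L)) = 1)
    [MeasurableSpace (Gqs L v)] [BorelSpace (Gqs L v)]
    [∀ γ : Gqs L v, MeasurableSpace (Gqs L v ⧸ Subgroup.centralizer ({γ} : Set (Gqs L v)))] [∀ γ : Gqs L v, BorelSpace (Gqs L v ⧸ Subgroup.centralizer ({γ} : Set (Gqs L v)))]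
    [MeasurableSpace (Gqs L v ⧸ Subgroup.center (Gqs L v))]
    {H : Type} [Group H] [TopologicalSpace H] [IsTopologicalGroup H] [MeasurableSpace H]
    (νQv : Measure (Gqs L v)) [νQv.IsHaarMeasure] [νQv.IsMulRightInvariant] (mQv : OrbitalMeasureFamily (Gqs L v))
    (hcanQ : mQv.IsCanonical (fun γ => IsRegularElt (γ.val : GL (Fin 3) (UnitaryGroup.LocalRing L v))) νQv)
    (𝔇 : EllipticData (Gqs L v) H) (hμG : 𝔇.μG = νQv) (horb : 𝔇.orb = mQv)
    (hreg : ∀ γ : Gqs L v, γ ∈ 𝔇.regG ↔ IsRegularElt (γ.val : GL (Fin 3) (UnitaryGroup.LocalRing L v)))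
    (hE : ∀ γ : Gqs L v, γ ∈ 𝔇.ellG ↔ IsRegularElt (γ.val : GL (Fin 3) (UnitaryGroup.LocalRing L v)) ∧ γ ∉ hyperbolicSet L v)
    (hM1 : ∀ π : IrrClass (Gqs L v), Measurable (𝔇.char π) ∧ LocallyIntegrable (𝔇.char π) 𝔇.μG ∧ (∀ x ∈ 𝔇.regG, ∀ᶠ y in 𝓝 x, 𝔇.char π y = 𝔇.char π x) ∧
      ∀ φ : Gqs L v → ℂ, IsLocSmooth φ → π.smoothTrace 𝔇.μG φ = ∫ x, φ x * 𝔇.char π x ∂𝔇.μG)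
    (hWIF : 𝔇.WeylIntegrationFormula) (hC1 : 𝔇.EllCartanSubset) (hC2 : 𝔇.EllCartanAE) (hC3 : 𝔇.NonEllCartanAE) (hL2 : 𝔇.L2CharOnTorusAll)   -- ★ PCT-OUT's extra letters
    -- ★ ELL-CLASS's inputs VERBATIM (`hRedJH` = ★ RED-JH's conclusion)
    (hVan : ∀ (π : IrrClass (Gqs L v)) (χ₁ : (UnitaryGroup.LocalRing L v)ˣ →* ℂˣ) (χ₂ : ↥(normOneUnits (conjLocal L (IsCMField.complexConj L) v)) →* ℂˣ),
      Continuous (fun x => ((χ₁ x : ℂˣ) : ℂ)) → Continuous (fun x => ((χ₂ x : ℂˣ) : ℂ)) →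
      (UnitaryGroup.cmPrincipalSeries L 3 v (UnitaryGroup.cmTorusCharPair L v χ₁ χ₂)).IsIrreducible →
      π.IsConstituentOf (UnitaryGroup.cmPrincipalSeries L 3 v (UnitaryGroup.cmTorusCharPair L v χ₁ χ₂)) →
      ∀ γ ∈ 𝔇.ellG, 𝔇.char π γ = 0)
    (hLds2 : 𝔇.LdsCardTwo)
    (hRedJH : ∀ (χ₁ : (UnitaryGroup.LocalRing L v)ˣ →* ℂˣ) (χ₂ : ↥(normOneUnits (conjLocal L (IsCMField.complexConj L) v)) →* ℂˣ),
      Continuous (fun x => ((χ₁ x : ℂˣ) : ℂ)) → Continuous (fun x => ((χ₂ x : ℂˣ) : ℂ)) →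
      ¬ (UnitaryGroup.cmPrincipalSeries L 3 v (UnitaryGroup.cmTorusCharPair L v χ₁ χ₂)).IsIrreducible →
      (∃ P ∈ 𝔇.ldsPackets, ∀ c : IrrClass (Gqs L v),
          c.IsConstituentOf (UnitaryGroup.cmPrincipalSeries L 3 v (UnitaryGroup.cmTorusCharPair L v χ₁ χ₂)) ↔ c ∈ P) ∨
      (∃ ψ : ↥(Subgroup.center (Gqs L v)) →* ℂˣ, Continuous ψ ∧ ∀ c : IrrClass (Gqs L v),
          c.IsConstituentOf (UnitaryGroup.cmPrincipalSeries L 3 v (UnitaryGroup.cmTorusCharPair L v χ₁ χ₂)) ↔ (c = 𝔇.stG ψ ∨ c = 𝔇.detG ψ)) ∨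
      (∃ ξ' : H →* ℂˣ, Continuous ξ' ∧ ∀ c : IrrClass (Gqs L v),
          c.IsConstituentOf (UnitaryGroup.cmPrincipalSeries L 3 v (UnitaryGroup.cmTorusCharPair L v χ₁ χ₂)) ↔ (c = 𝔇.pi2 ξ' ∨ c = 𝔇.piN ξ'))) :
    ∀ π π' : IrrClass (Gqs L v), 𝔇.IsEllipticRep π → 𝔇.IsEllipticRep π' → ¬ π.IsSupercuspidal → ¬ π'.IsSupercuspidal →
      𝔇.innerG (𝔇.char π) (𝔇.char π') ≠ 0 → π ≠ π' → 𝔇.IsEllipticPair π π' := by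
  haveI := locallyCompactSpace_cmBorelU L 3 v
  intro π π' hπ hπ' hsc hsc' hinner hne
  -- (0) realise both classes inside principal series (★ D2′; the supercuspidal branch is excluded)
  obtain ⟨r, hr, χ₁, χ₂, h1c, h2c, φ, hφ⟩ : ∃ r : SmoothIrrep (Gqs L v), IrrClass.mk r = π ∧
      ∃ (χ₁ : (LocalRing L v)ˣ →* ℂˣ) (χ₂ : ↥(normOneUnits (conjLocal L (IsCMField.complexConj L) v)) →* ℂˣ),
        Continuous (fun x => ((χ₁ x : ℂˣ) : ℂ)) ∧ Continuous (fun x => ((χ₂ x : ℂˣ) : ℂ)) ∧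
        ∃ f : r.ρ.IntertwiningMap (cmPrincipalSeries L 3 v (cmTorusCharPair L v χ₁ χ₂)), Function.Injective f :=
    (F0P3JacquetEmbeddingDichotomy.isSupercuspidal_or_exists_injective_intertwiningMap_cmPrincipalSeries_of_irrClass L v hns π).resolve_left hsc
  obtain ⟨r', hr', χ₁', χ₂', h1c', h2c', φ', hφ'⟩ : ∃ r' : SmoothIrrep (Gqs L v), IrrClass.mk r' = π' ∧
      ∃ (χ₁' : (LocalRing L v)ˣ →* ℂˣ) (χ₂' : ↥(normOneUnits (conjLocal L (IsCMField.complexConj L) v)) →* ℂˣ),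
        Continuous (fun x => ((χ₁' x : ℂˣ) : ℂ)) ∧ Continuous (fun x => ((χ₂' x : ℂˣ) : ℂ)) ∧
        ∃ f : r'.ρ.IntertwiningMap (cmPrincipalSeries L 3 v (cmTorusCharPair L v χ₁' χ₂')), Function.Injective f :=
    (F0P3JacquetEmbeddingDichotomy.isSupercuspidal_or_exists_injective_intertwiningMap_cmPrincipalSeries_of_irrClass L v hns π').resolve_left hsc'
  -- both series are REDUCIBLE (their constituents `π`, `π′` are elliptic: ★ `hVan`)
  have hπ'c : π'.IsConstituentOf (cmPrincipalSeries L 3 v (cmTorusCharPair L v χ₁' χ₂')) := by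
    rw [← hr']; exact (IrrClass.isConstituentOf_mk_self r').of_injective φ' hφ'
  have hπc : π.IsConstituentOf (cmPrincipalSeries L 3 v (cmTorusCharPair L v χ₁ χ₂)) := by
    rw [← hr]; exact (IrrClass.isConstituentOf_mk_self r).of_injective φ hφ
  have hI'red : ¬ (cmPrincipalSeries L 3 v (cmTorusCharPair L v χ₁' χ₂')).IsIrreducible := by
    intro hirr
    obtain ⟨γ, hγ, hne0⟩ := hπ'
    exact hne0 (hVan π' χ₁' χ₂' h1c' h2c' hirr hπ'c γ hγ)
  have hIred : ¬ (cmPrincipalSeries L 3 v (cmTorusCharPair L v χ₁ χ₂)).IsIrreducible := by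
    intro hirr
    obtain ⟨γ, hγ, hne0⟩ := hπ
    exact hne0 (hVan π χ₁ χ₂ h1c h2c hirr hπc γ hγ)
  -- (1) THE CLAIM: `π` is a constituent of `I′ = i_G(χ′)` — by block separation + the cross-trace socket
  have hA : π.IsConstituentOf (cmPrincipalSeries L 3 v (cmTorusCharPair L v χ₁' χ₂')) := by
    by_contra hB
    -- the two inducing characters differ (else `I = I′` and `π ∈ JH(I′)` via `φ`)
    have hneχ : cmTorusCharPair L v χ₁' χ₂' ≠ cmTorusCharPair L v χ₁ χ₂ := by
      intro heq
      apply hB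
      rw [heq]
      exact hπc
    -- the Jacquet line of `r` (§1): `T` acts on `r_B(r)` by `χ`
    have hθ := normalizedJacquet_eq_smul_of_injective_of_not_isIrreducible L v hns χ₁ χ₂ h1c h2c r φ hφ hIred
    -- every smooth extension `0 → r′ → E → r → 0` SPLITS (★ 79 (SEP); the other alternative embeds `E` in `I′` and puts `π` in `JH(I′)`)
    have hsplit₂ : ∀ (E : Type) [AddCommGroup E] [Module ℂ E] (ρE : Representation ℂ (Gqs L v) E), ρE.IsSmooth →
        ∀ (i : r'.ρ.IntertwiningMap ρE) (p : ρE.IntertwiningMap r.ρ), Function.Injective i → LinearMap.ker p.toLinearMap = LinearMap.range i.toLinearMap →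
          Function.Surjective p → ∃ s : r.ρ.IntertwiningMap ρE, p.comp s = Representation.IntertwiningMap.id r.ρ := by
      intro E _ _ ρE hE i p hi hker hp
      have hVirr : ∀ S : Submodule ℂ r.V, (∀ g, S ≤ S.comap (r.ρ g)) → S = ⊥ ∨ S = ⊤ := by
        intro S hS
        haveI : IsSimpleOrder (Subrepresentation r.ρ) := r.isIrreducible
        rcases IsSimpleOrder.eq_bot_or_eq_top (⟨S, fun g _ hx => hS g hx⟩ : Subrepresentation r.ρ) with h | h
        · exact Or.inl (congrArg Subrepresentation.toSubmodule h)
        · exact Or.inr (congrArg Subrepresentation.toSubmodule h)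
      let σ' : Representation ℂ ↥(cmBorelTriple L 3 v).M ℂ :=
        (Representation.trivial ℂ ↥(torusU (conjLocal L (IsCMField.complexConj L) v) (cmLocalForm L 3 v)) ℂ).twist (cmTorusCharPair L v χ₁' χ₂')
      have hσ' : ∀ (m : ↥(cmBorelTriple L 3 v).M) (y : ℂ), σ' m y = ((cmTorusCharPair L v χ₁' χ₂' m : ℂˣ) : ℂ) • y := fun m y => by
        simp only [σ', Representation.twist_apply, Representation.trivial_apply]
      let ι : r'.ρ.IntertwiningMap (Representation.normalizedInd (cmBorelTriple L 3 v) σ') := φ'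
      have hι : Function.Injective ι := hφ'
      rcases Representation.exists_section_or_exists_injective_of_isotypic_normalizedJacquet (cmBorelTriple L 3 v)
          (isLimitOfCompactOpen_cmBorelTriple_N L 3 v) (deltaChar_cmBorelTriple_eq_one_of_mem_N L 3 v)
          (fun m m' => torusU_mul_comm _ _ m m') r'.isSmooth hE i p hi hker hp hVirr
          (cmTorusCharPair L v χ₁ χ₂) hθ σ' (cmTorusCharPair L v χ₁' χ₂') hσ' hneχ ι hι with hs | ⟨Φ, hΦ, -⟩
      · exact hs
      · exact absurd (((IrrClass.isConstituentOf_mk_self r).of_surjective p hp).of_injective Φ hΦ) (by rw [hr]; exact hB)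
    -- Schur for the distinct classes, then the socket contradicts `⟨χ_π, χ_π′⟩ ≠ 0`
    have hHom0 : Subsingleton (r.ρ.IntertwiningMap r'.ρ) :=
      SmoothIrrep.subsingleton_intertwiningMap_of_mk_ne_mk r r' (by rw [hr, hr']; exact hne)
    have h0 := F0P3cStCharTSEPCrossNormZeroNotWild.innerG_char_cross_eq_zero_of_not_wild L v hns hv νQv mQv hcanQ 𝔇 hμG horb hreg hE hM1 hWIF hC1 hC2 hC3 hL2 r r' hsplit₂ hHom0
    rw [hr, hr'] at h0
    exact F0P3cStCharTSP1261bOfCases.innerG_ne_zero_comm 𝔇 hinner h0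
  -- (2) `π, π′ ∈ JH(I′)`, `I′` reducible: Rogawski's list names the pair
  rcases hRedJH χ₁' χ₂' h1c' h2c' hI'red with ⟨P, hP, hmem⟩ | ⟨ψ, hψc, hmem⟩ | ⟨ξ', hξc, hmem⟩
  · -- an l.d.s. packet `P ∋ π, π′`; `P` has exactly two members (★ `LdsCardTwo`)
    refine Or.inl ⟨P, hP, fun σ => ⟨fun hσ => ?_, fun hσ => ?_⟩⟩
    · obtain ⟨τ, hτP, hτne, hall⟩ := hLds2 P hP π ((hmem π).1 hA)
      rcases hall σ hσ with h | h
      · exact Or.inl h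
      · rcases hall π' ((hmem π').1 hπ'c) with h' | h'
        · exact absurd h'.symm hne
        · exact Or.inr (h.trans h'.symm)
    · rcases hσ with rfl | rfl
      · exact (hmem _).1 hA
      · exact (hmem _).1 hπ'c
  · -- the EP family `{St_G ψ, ψ∘det_G}`
    refine Or.inr (Or.inl ⟨ψ, hψc, ?_⟩)
    rcases (hmem π).1 hA with h1 | h1 <;> rcases (hmem π').1 hπ'c with h2 | h2
    · exact absurd (h1.trans h2.symm) hne
    · exact Or.inl ⟨h1, h2⟩
    · exact Or.inr ⟨h1, h2⟩
    · exact absurd (h1.trans h2.symm) hne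
  · -- Keys' family `{π²(ξ′), πⁿ(ξ′)}`
    refine Or.inr (Or.inr ⟨ξ', hξc, ?_⟩)
    rcases (hmem π).1 hA with h1 | h1 <;> rcases (hmem π').1 hπ'c with h2 | h2
    · exact absurd (h1.trans h2.symm) hne
    · exact Or.inl ⟨h1, h2⟩
    · exact Or.inr ⟨h1, h2⟩
    · exact absurd (h1.trans h2.symm) hne

end Summit.HodgeConjecture.HodgeConjecture.Cruxes.H413.F0P3cStCharTSP1261bRestNotWild

end
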